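/-
COR-CM (cell pub-hodgecm2, stage 2 of the Hodge ladder) — count-neutral KERNEL COMBINATORICS «index-two descent of abstract CM types: the action of the
odd coset and the blocks» (seat prover-pub-hodgecm2-b23-g41-0, binder prover b23, gen 41; claim QUARTIC-TRANSPORT, CLAIM-ADDENDUM #1 «INDEX-TWO DESCENT»,
HOME/INBOX.md l.10136; blanket `Census/IndexTwoDescent*` l.10149).
Bookkeeping definitions with bodies (`conjPull`, `pushTwist`) + theorems, on top of parts I/II (`Census/IndexTwoDescentDictionary.lean`,
`Census/IndexTwoDescentHodge.lean`) and `Census/BlockParityLaw.lean` used BY NAME; no `decide`, no certificate, no named fact, no `sorry`; `Interfaces.lean` (C1),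
every E term, B01, `Transposition/*`, `PortJoin/*` untouched.
HONEST FRAMING: `HC_CM` is NOT proved, here or anywhere in the tree; nothing here is a period, a count of record or a headline.
T5: n/a-class (hypothesis binders: `c ∈ H`, `c` central, `x ∉ H`, `H.index = 2` only); checker: self, 2026-08-23.
-/
import Summits.HodgeConjecture.CorCM.Census.IndexTwoDescentHodge

/-!
# Index-two descent of abstract CM types, III: base change along the odd coset, and the blocks

Parts I/II split `Ψ ↦ (res₀ Ψ, res₁ Ψ)` along an index-two subgroup `H ∋ c` (`c` central) with a chosen `x ∉ H`, and showed that base change along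
`Q ∈ H` is DIAGONAL.  Here the base change along `x` itself: with the two `x`-twists of CM types of `(H, c)`

  `conjPull T = {h | x⁻¹ h x ∈ T}` and `pushTwist T = {h | x h x ∈ T}` (§1; `H` is normal, `x² ∈ H`),

one has **`res₀ (Ψ·x⁻¹) = conjPull (res₁ Ψ)`** and **`res₁ (Ψ·x⁻¹) = pushTwist (res₀ Ψ)`** (§2, `res₀_rt_x`, `res₁_rt_x`): the coordinates SWAP up to
`x`-conjugation and the `x²`-shift (`conjPull ∘ pushTwist = pushTwist ∘ conjPull = (·)·(x²)⁻¹`, `conjPull_pushTwist`, `pushTwist_conjPull`) — seat b09's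
«σ(s₀,s₁) = (tw (1,0) s₁, s₀), σ² = diagonal tw (1,0)» of the octic road map in the intrinsic currency.  §3: two types of `(G, c)` lie in one BLOCK iff their
pairs differ by a diagonal base change along `H`, possibly composed with the swap-twist (`blk_eq_blk_iff`) — the Burnside-ready form of `β(G, c)` on pairs.

## References
* [Milne1999] J. S. Milne, Lefschetz motives and the Tate conjecture, Compositio Math. 117 (1999), Prop. 2.1, p. 54.
-/

namespace Summit.HodgeConjecture.CorCM.Census.IndexTwoDescent

open Finset
open Summit.HodgeConjecture.CorCM.Prior.AllgGroup.RfwfAllgGroup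
open Summit.HodgeConjecture.CorCM.Census.BlockParity

noncomputable section

variable {G : Type*} [Group G] [Fintype G] [DecidableEq G] {c : G}
variable {H : Subgroup G} [DecidablePred (· ∈ H)]

/-! ## §1 The two `x`-twists of CM types of `(H, c)` -/

omit [Fintype G] [DecidableEq G] [DecidablePred (· ∈ H)] in
/-- `x⁻¹ h x ∈ H` (an index-two subgroup is normal). [folklore] -/
theorem inv_mul_mul_mem (hH : H.index = 2) (x : G) (h : H) : x⁻¹ * (h : G) * x ∈ H := by
  haveI := Subgroup.normal_of_index_eq_two hH
  simpa using (inferInstance : H.Normal).conj_mem (h : G) h.2 x⁻¹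

omit [Fintype G] [DecidableEq G] [DecidablePred (· ∈ H)] in
/-- `x h x ∈ H` for `x ∉ H` (`x h x⁻¹ ∈ H` and `x² ∈ H`). [folklore] -/
theorem mul_mul_mem (hH : H.index = 2) {x : G} (hx : x ∉ H) (h : H) : x * (h : G) * x ∈ H := by
  rw [Subgroup.mul_mem_iff_of_index_two hH, mul_mem_iff_not_mem hH hx]
  exact ⟨fun hn => absurd h.2 hn, fun hxH => absurd hxH hx⟩

/-- **The conjugation pull-back** `conjPull T = {h ∈ H | x⁻¹ h x ∈ T}`, a CM type of `(H, c)` (`c` central). [folklore] -/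
def conjPull (hcH : c ∈ H) (hcen : ∀ g : G, g * c = c * g) (hH : H.index = 2) (x : G) (T : CMF H ⟨c, hcH⟩) : CMF H ⟨c, hcH⟩ :=
  ⟨univ.filter fun h : H => (⟨x⁻¹ * (h : G) * x, inv_mul_mul_mem hH x h⟩ : H) ∈ T.1, fun h => by
    simp only [mem_filter, mem_univ, true_and]
    have e : (⟨x⁻¹ * ((⟨c, hcH⟩ * h : H) : G) * x, inv_mul_mul_mem hH x (⟨c, hcH⟩ * h)⟩ : H) =
        ⟨c, hcH⟩ * ⟨x⁻¹ * (h : G) * x, inv_mul_mul_mem hH x h⟩ := by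
      apply Subtype.ext
      simp only [Subgroup.coe_mul, ← mul_assoc]
      rw [hcen x⁻¹]
    rw [e]
    exact T.2 _⟩

/-- **The push-twist** `pushTwist T = {h ∈ H | x h x ∈ T}`, a CM type of `(H, c)` (`c` central, `x ∉ H`). [folklore] -/
def pushTwist (hcH : c ∈ H) (hcen : ∀ g : G, g * c = c * g) (hH : H.index = 2) {x : G} (hx : x ∉ H) (T : CMF H ⟨c, hcH⟩) : CMF H ⟨c, hcH⟩ :=
  ⟨univ.filter fun h : H => (⟨x * (h : G) * x, mul_mul_mem hH hx h⟩ : H) ∈ T.1, fun h => by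
    simp only [mem_filter, mem_univ, true_and]
    have e : (⟨x * ((⟨c, hcH⟩ * h : H) : G) * x, mul_mul_mem hH hx (⟨c, hcH⟩ * h)⟩ : H) =
        ⟨c, hcH⟩ * ⟨x * (h : G) * x, mul_mul_mem hH hx h⟩ := by
      apply Subtype.ext
      simp only [Subgroup.coe_mul, ← mul_assoc]
      rw [hcen x]
    rw [e]
    exact T.2 _⟩

/-- Membership in the conjugation pull-back. [folklore] -/
@[simp] theorem mem_conjPull (hcH : c ∈ H) (hcen : ∀ g : G, g * c = c * g) (hH : H.index = 2) (x : G) (T : CMF H ⟨c, hcH⟩) (h : H) :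
    h ∈ (conjPull hcH hcen hH x T).1 ↔ (⟨x⁻¹ * (h : G) * x, inv_mul_mul_mem hH x h⟩ : H) ∈ T.1 := by
  simp [conjPull]

/-- Membership in the push-twist. [folklore] -/
@[simp] theorem mem_pushTwist (hcH : c ∈ H) (hcen : ∀ g : G, g * c = c * g) (hH : H.index = 2) {x : G} (hx : x ∉ H) (T : CMF H ⟨c, hcH⟩) (h : H) :
    h ∈ (pushTwist hcH hcen hH hx T).1 ↔ (⟨x * (h : G) * x, mul_mul_mem hH hx h⟩ : H) ∈ T.1 := by
  simp [pushTwist]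

/-! ## §2 Base change along `x` swaps the coordinates up to the twists -/

/-- **`res₀ (Ψ·x⁻¹) = conjPull (res₁ Ψ)`.** [folklore] -/
theorem res₀_rt_x (hcH : c ∈ H) (hcen : ∀ g : G, g * c = c * g) (hH : H.index = 2) (x : G) (Ψ : CMF G c) :
    res₀ hcH (rt c x Ψ) = conjPull hcH hcen hH x (res₁ hcH hcen x Ψ) := by
  apply Subtype.ext; ext h
  rw [coe_mem_res₀_rt_x_iff, mem_conjPull, mem_res₁]

/-- **`res₁ (Ψ·x⁻¹) = pushTwist (res₀ Ψ)`.** [folklore] -/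
theorem res₁_rt_x (hcH : c ∈ H) (hcen : ∀ g : G, g * c = c * g) (hH : H.index = 2) {x : G} (hx : x ∉ H) (Ψ : CMF G c) :
    res₁ hcH hcen x (rt c x Ψ) = pushTwist hcH hcen hH hx (res₀ hcH Ψ) := by
  apply Subtype.ext; ext h
  rw [mem_res₁_rt_iff, mem_pushTwist, mem_res₀]

omit [Fintype G] [DecidableEq G] [DecidablePred (· ∈ H)] in
/-- `x² ∈ H` (index two). [folklore] -/
theorem mul_self_mem (hH : H.index = 2) (x : G) : x * x ∈ H := by
  rw [Subgroup.mul_mem_iff_of_index_two hH]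

/-- **`conjPull (pushTwist T) = T·(x²)⁻¹`**: the swap-twist squares to the diagonal base change along `x² ∈ H`. [folklore] -/
theorem conjPull_pushTwist (hcH : c ∈ H) (hcen : ∀ g : G, g * c = c * g) (hH : H.index = 2) {x : G} (hx : x ∉ H) (T : CMF H ⟨c, hcH⟩) :
    conjPull hcH hcen hH x (pushTwist hcH hcen hH hx T) = rt (⟨c, hcH⟩ : H) ⟨x * x, mul_self_mem hH x⟩ T := by
  apply Subtype.ext; ext h
  rw [mem_conjPull, mem_pushTwist, mem_rt]
  have e : (⟨x * ((⟨x⁻¹ * (h : G) * x, inv_mul_mul_mem hH x h⟩ : H) : G) * x,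
      mul_mul_mem hH hx ⟨x⁻¹ * (h : G) * x, inv_mul_mul_mem hH x h⟩⟩ : H) = h * ⟨x * x, mul_self_mem hH x⟩ := by
    apply Subtype.ext
    simp only [Subgroup.coe_mul, ← mul_assoc, mul_inv_cancel, one_mul]
  rw [e]

/-- **`pushTwist (conjPull T) = T·(x²)⁻¹`.** [folklore] -/
theorem pushTwist_conjPull (hcH : c ∈ H) (hcen : ∀ g : G, g * c = c * g) (hH : H.index = 2) {x : G} (hx : x ∉ H) (T : CMF H ⟨c, hcH⟩) :
    pushTwist hcH hcen hH hx (conjPull hcH hcen hH x T) = rt (⟨c, hcH⟩ : H) ⟨x * x, mul_self_mem hH x⟩ T := by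
  apply Subtype.ext; ext h
  rw [mem_pushTwist, mem_conjPull, mem_rt]
  have e : (⟨x⁻¹ * ((⟨x * (h : G) * x, mul_mul_mem hH hx h⟩ : H) : G) * x,
      inv_mul_mul_mem hH x ⟨x * (h : G) * x, mul_mul_mem hH hx h⟩⟩ : H) = h * ⟨x * x, mul_self_mem hH x⟩ := by
    apply Subtype.ext
    simp only [Subgroup.coe_mul, ← mul_assoc, inv_mul_cancel, one_mul]
  rw [e]

/-! ## §3 The blocks of `(G, c)` on pairs -/

/-- **Blocks on pairs.**  Two CM types of `(G, c)` lie in one block iff their pairs differ by a DIAGONAL base change along some `h ∈ H`, or by a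
diagonal base change followed by the swap-twist `(T₀, T₁) ↦ (conjPull T₁, pushTwist T₀)` (base change along `x·h`). [folklore] -/
theorem blk_eq_blk_iff (hcH : c ∈ H) (hcen : ∀ g : G, g * c = c * g) (hH : H.index = 2) {x : G} (hx : x ∉ H) (Ψ Ψ' : CMF G c) :
    blk c Ψ = blk c Ψ' ↔
      (∃ h : H, res₀ hcH Ψ' = rt (⟨c, hcH⟩ : H) h (res₀ hcH Ψ) ∧ res₁ hcH hcen x Ψ' = rt (⟨c, hcH⟩ : H) h (res₁ hcH hcen x Ψ)) ∨
      (∃ h : H, res₀ hcH Ψ' = conjPull hcH hcen hH x (rt (⟨c, hcH⟩ : H) h (res₁ hcH hcen x Ψ)) ∧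
        res₁ hcH hcen x Ψ' = pushTwist hcH hcen hH hx (rt (⟨c, hcH⟩ : H) h (res₀ hcH Ψ))) := by
  constructor
  · intro hb
    obtain ⟨Q, rfl⟩ := exists_rt_eq_of_blk_eq c hb
    by_cases hQ : Q ∈ H
    · exact Or.inl ⟨⟨Q, hQ⟩, res₀_rt_coe hcH ⟨Q, hQ⟩ Ψ, res₁_rt_coe hcH hcen x ⟨Q, hQ⟩ Ψ⟩
    · obtain ⟨h, rfl⟩ := exists_eq_mul_of_not_mem hH hx hQ
      refine Or.inr ⟨h, ?_, ?_⟩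
      · rw [rt_mul, res₀_rt_x hcH hcen hH, res₁_rt_coe]
      · rw [rt_mul, res₁_rt_x hcH hcen hH hx, res₀_rt_coe]
  · rintro (⟨h, h0, h1⟩ | ⟨h, h0, h1⟩)
    · rw [← ext_of_res hcH hcen hH hx (Ψ := rt c (h : G) Ψ) (Ψ' := Ψ') (by rw [res₀_rt_coe, h0]) (by rw [res₁_rt_coe, h1]), blk_rt]
    · rw [← ext_of_res hcH hcen hH hx (Ψ := rt c (x * (h : G)) Ψ) (Ψ' := Ψ')
        (by rw [rt_mul, res₀_rt_x hcH hcen hH, res₁_rt_coe, h0]) (by rw [rt_mul, res₁_rt_x hcH hcen hH hx, res₀_rt_coe, h1]), blk_rt]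

end

end Summit.HodgeConjecture.CorCM.Census.IndexTwoDescent
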